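import Summits.RiemannHypothesis.RiemannHypothesis.Theorems.GroundBartaPolarPerronFrobeniusSmallWindows
import HarnessLib
import Summits.RiemannHypothesis.RiemannHypothesis.Theorems.WeilRouteProps.GroundBarta

/-!
# RiemannHypothesis / GroundBarta — crux `PolarPerronFrobenius` (stmt-RiemannHypothesis-18390):
# the SIGN-DEFECT (negative-mass) CRITERION for Perron–Frobenius at an ARBITRARY window (RH-free)

Helper file (`--supports`), RH-free, Mathlib + proved tree files only, no definitions.

The small-window theorem (`…SmallWindows.lean`) used the threshold `2 cosh a ≤ w(2a)` only at the very
end.  Without it, the same computation gives at EVERY window `a > 0` a quantitative ROBUST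
sign-improvement bound: for a real window test `f = f⁺ − f⁻`, non-negative tests come within the
**polar sign defect**

  `G_a(f) := (8 cosh a − 4 w(2a)) · ∫f⁺ · ∫f⁻`     (`w(2a) = e^{a}/(2 sinh 2a)`; `G_a ≤ 0` iff `a ≤ 0.1406…`)

of the Rayleigh quotient of `f` (`sw_exists_nonneg_test_lt_polar`, `sw_cone_of_real_polar`).  Hence the
**negative-mass criterion** (`sw_coneDense_of_negMass`, `sw_GSP_of_negMass`): if the window carries
real normalised near-minimisers `f` whose polar sign defect is negligible — `Re Q(f) ≤ ε(a) + δ` and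
`G_a(f) ≤ δ` for every `δ > 0`, e.g. `cosh(a) ‖f⁻‖₁ ‖f⁺‖₁ → 0` along a minimising sequence — then
non-negative tests are energy-dense (cone density) and the FULL windowed Weil form has a ground state
that is real and `≥ 0` a.e. (`GSP a`); cofinally in `a` this gives the crux
(`polarPerronFrobenius_of_cofinal_negMass`).  So one-signedness of the bottom beyond the small-window
range needs NO sign mechanism beyond an `L¹`-smallness `o(e^{-a})` of the negative part of
near-minimisers (compare the edge-layer scale `e^{-2πe^{2a}}` of the numerics, CruxAttack-r1 F6) — a
robust target complementary to prover A's robust Barta floor (which weighs the negative part by `Φ`).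
Prover B, speedrun unit `sr-gb-rung-b` (rung 3).

References: E. Bombieri, Rend. Lincei (9) 11 (2000) Thm 2, §4; A. Beurling, J. Deny (1958).
-/

set_option linter.dupNamespace false

noncomputable section

open Set MeasureTheory Filter Complex
open scoped Real Topology

namespace Summit.RiemannHypothesis.RiemannHypothesis.Theorems.PolarPerronFrobenius

open Literature.NumberTheory.LFunctions
open Summit.RiemannHypothesis.RiemannHypothesis.Theorems.OddSector
open Summit.RiemannHypothesis.RiemannHypothesis.Theorems.WeilRouteProps.GroundBarta

/-! ## The robust sign-improvement bound at an arbitrary window -/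

section Polar

variable {f : ℝ → ℝ} {a : ℝ}

/-- **Robust sign improvement (test level, any window).**  Let `a > 0`, `f` a real smooth function
with `tsupport f ⊆ [-a, a]`, `‖f‖₂ = 1`, and `G = (8 cosh a − 4 w(2a)) ∫f⁺ ∫f⁻` its polar sign
defect.  For every `δ > 0` some approximant `w_η = ψ_η ∘ f` (`η > 0`; smooth, non-negative,
`tsupport w_η ⊆ tsupport f`) has `‖w_η‖₂ > 0` and `Re Q(w_η) < ‖w_η‖₂² (Re Q(f) + G + δ)`. [folklore] -/
theorem sw_exists_nonneg_test_lt_polar (hf : ContDiff ℝ (⊤ : ℕ∞) f) (hfs : HasCompactSupport f)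
    (ha : 0 < a) (hsupp : tsupport f ⊆ Icc (-a) a) (hnorm : ∫ t, ‖((f t : ℝ) : ℂ)‖ ^ 2 = 1)
    {δ : ℝ} (hδ : 0 < δ) :
    ∃ η : ℝ, 0 < η ∧ 0 < ∫ t, ‖((Real.sqrt (f t ^ 2 + η ^ 2) - η : ℝ) : ℂ)‖ ^ 2 ∧
      (weilQuadratic (fun t => ((Real.sqrt (f t ^ 2 + η ^ 2) - η : ℝ) : ℂ))).re <
        (∫ t, ‖((Real.sqrt (f t ^ 2 + η ^ 2) - η : ℝ) : ℂ)‖ ^ 2) *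
          ((weilQuadratic (fun t => ((f t : ℝ) : ℂ))).re +
            (8 * Real.cosh a - 4 * weilArchDensity (2 * a)) * (∫ t, max (f t) 0) * (∫ t, max (-f t) 0) +
            δ) := by
  have hfc : Continuous f := hf.continuous
  have hsupp' : Function.support f ⊆ Icc (-a) a := (subset_tsupport f).trans hsupp
  set G : ℝ := (8 * Real.cosh a - 4 * weilArchDensity (2 * a)) * (∫ t, max (f t) 0) *
    (∫ t, max (-f t) 0) with hG
  set QF : ℝ := (weilQuadratic (fun t => ((f t : ℝ) : ℂ))).re with hQF
  set PF : ℝ := weilPoleForm (fun t => ((f t : ℝ) : ℂ)) with hPF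
  set PA : ℝ := weilPoleForm (fun t => ((|f t| : ℝ) : ℂ)) with hPA
  set IF : ℂ := ∫ t, ((f t : ℝ) : ℂ) with hIF
  set IA : ℂ := ∫ t, ((|f t| : ℝ) : ℂ) with hIA
  set w2 : ℝ := weilArchDensity (2 * a) with hw2
  set M : ℝ := weilMarkovConstant a with hM
  set Nw : ℝ → ℝ := fun η => ∫ t, ‖((Real.sqrt (f t ^ 2 + η ^ 2) - η : ℝ) : ℂ)‖ ^ 2 with hNw
  set Pw : ℝ → ℝ := fun η => weilPoleForm (fun t => ((Real.sqrt (f t ^ 2 + η ^ 2) - η : ℝ) : ℂ))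
    with hPw
  set Iw : ℝ → ℂ := fun η => ∫ t, ((Real.sqrt (f t ^ 2 + η ^ 2) - η : ℝ) : ℂ) with hIw
  set U : ℝ → ℝ := fun η => QF + (Pw η - PF) +
      w2 * ((4 * a * Nw η - ‖Iw η‖ ^ 2) - (4 * a * 1 - ‖IF‖ ^ 2)) - M * (Nw η - 1) -
      Nw η * (QF + G + δ) with hU
  -- (1) the per-`η` inequality
  have hUle : ∀ η : ℝ, 0 < η →
      (weilQuadratic (fun t => ((Real.sqrt (f t ^ 2 + η ^ 2) - η : ℝ) : ℂ))).re -
        Nw η * (QF + G + δ) ≤ U η := by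
    intro η hη
    have h := sw_re_weilQuadratic_psi_sub_le hf hfs ha hsupp hη
    rw [hnorm] at h
    simp only [hU, hNw, hPw, hIw, hQF, hPF, hIF, hw2, hM]
    linarith
  -- (2) the limit of `U`
  have hN : Tendsto Nw (𝓝[>] 0) (𝓝 1) := by
    have h := sw_tendsto_integral_norm_sq_psi hfc hfs
    rwa [hnorm] at h
  have hP : Tendsto Pw (𝓝[>] 0) (𝓝 PA) := sw_tendsto_weilPoleForm_psi hfc hsupp'
  have hI : Tendsto Iw (𝓝[>] 0) (𝓝 IA) := sw_tendsto_integral_psi hfc hsupp'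
  set U0 : ℝ := QF + (PA - PF) + w2 * ((4 * a * 1 - ‖IA‖ ^ 2) - (4 * a * 1 - ‖IF‖ ^ 2)) -
      M * (1 - 1) - 1 * (QF + G + δ) with hU0
  have hUlim : Tendsto U (𝓝[>] 0) (𝓝 U0) := by
    have t1 : Tendsto (fun η => QF + (Pw η - PF)) (𝓝[>] 0) (𝓝 (QF + (PA - PF))) :=
      tendsto_const_nhds.add (hP.sub tendsto_const_nhds)
    have t2 : Tendsto (fun η => w2 * ((4 * a * Nw η - ‖Iw η‖ ^ 2) - (4 * a * 1 - ‖IF‖ ^ 2)))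
        (𝓝[>] 0) (𝓝 (w2 * ((4 * a * 1 - ‖IA‖ ^ 2) - (4 * a * 1 - ‖IF‖ ^ 2)))) :=
      (((hN.const_mul (4 * a)).sub (hI.norm.pow 2)).sub tendsto_const_nhds).const_mul w2
    have t3 : Tendsto (fun η => M * (Nw η - 1)) (𝓝[>] 0) (𝓝 (M * (1 - 1))) :=
      (hN.sub tendsto_const_nhds).const_mul M
    have t4 : Tendsto (fun η => Nw η * (QF + G + δ)) (𝓝[>] 0) (𝓝 (1 * (QF + G + δ))) :=
      hN.mul tendsto_const_nhds
    rw [hU, hU0]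
    exact ((t1.add t2).sub t3).sub t4
  -- (3) the limit is negative: polar loss ≤ Dirichlet gain + defect
  have hgain : PA - PF ≤ w2 * (‖IA‖ ^ 2 - ‖IF‖ ^ 2) + G := by
    have h1 := sw_weilPoleForm_abs_sub_le hfc hfs ha.le hsupp'
    have h2 := sw_norm_sq_integral_abs_sub_eq hfc hfs
    simp only [hPA, hPF, hIA, hIF, hw2, hG]
    rw [h2]
    nlinarith
  have hU0neg : U0 < 0 := by
    simp only [hU0]
    linarith
  -- (4) pick `η`
  have hev1 : ∀ᶠ η in 𝓝[>] (0 : ℝ), U η < 0 := (tendsto_order.1 hUlim).2 _ hU0neg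
  have hev2 : ∀ᶠ η in 𝓝[>] (0 : ℝ), 1 / 2 < Nw η := (tendsto_order.1 hN).1 _ (by norm_num)
  have hev3 : ∀ᶠ η in 𝓝[>] (0 : ℝ), 0 < η := self_mem_nhdsWithin
  obtain ⟨η, hη1, hη2, hη3⟩ := (hev1.and (hev2.and hev3)).exists
  refine ⟨η, hη3, by simp only [hNw] at hη2; linarith, ?_⟩
  have h := hUle η hη3
  simp only [hNw, hG] at h hη2 ⊢
  linarith

/-- **Real case, any window.**  A real normalised window test `f` is matched by a normalised
NON-NEGATIVE real window test `w` with `Re Q(w) ≤ Re Q(f) + (8cosh a − 4w(2a))∫f⁺∫f⁻ + δ`, even if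
`f` is even. [folklore] -/
theorem sw_cone_of_real_polar (ha : 0 < a) (hF : IsWeilTest fun t => ((f t : ℝ) : ℂ))
    (hsupp : tsupport (fun t => ((f t : ℝ) : ℂ)) ⊆ Icc (-a) a)
    (hnorm : ∫ t, ‖((f t : ℝ) : ℂ)‖ ^ 2 = 1) {δ : ℝ} (hδ : 0 < δ) :
    ∃ w : ℝ → ℂ, IsWeilTest w ∧ tsupport w ⊆ Icc (-a) a ∧ (∀ t, (w t).im = 0 ∧ 0 ≤ (w t).re) ∧
      ∫ t, ‖w t‖ ^ 2 = 1 ∧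
      (weilQuadratic w).re ≤ (weilQuadratic fun t => ((f t : ℝ) : ℂ)).re +
        (8 * Real.cosh a - 4 * weilArchDensity (2 * a)) * (∫ t, max (f t) 0) * (∫ t, max (-f t) 0) +
        δ ∧
      ((∀ t, f (-t) = f t) → ∀ t, w (-t) = w t) := by
  have hf := sw_contDiff_of_isWeilTest_ofReal hF
  have hfs := sw_hasCompactSupport_of_isWeilTest_ofReal hF
  have hsuppR : tsupport f ⊆ Icc (-a) a := (sw_tsupport_ofReal_comp f) ▸ hsupp
  obtain ⟨η, hη, hNpos, hlt⟩ := sw_exists_nonneg_test_lt_polar hf hfs ha hsuppR hnorm hδ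
  set W : ℝ → ℂ := fun t => ((Real.sqrt (f t ^ 2 + η ^ 2) - η : ℝ) : ℂ) with hWdef
  set N : ℝ := ∫ t, ‖W t‖ ^ 2 with hN
  have hW : IsWeilTest W := sw_isWeilTest_psi_comp hf hfs hη
  have hWs : tsupport W ⊆ Icc (-a) a := (sw_tsupport_psi_comp_subset hη.le).trans hsuppR
  set c : ℝ := (Real.sqrt N)⁻¹ with hc
  have hcpos : 0 < c := inv_pos.2 (Real.sqrt_pos.2 hNpos)
  have hcc : c * c = 1 / N := by
    rw [hc, ← mul_inv, Real.mul_self_sqrt hNpos.le, one_div]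
  refine ⟨fun t => (c : ℂ) * W t, hW.const_mul c, tsupport_mul_subset_right.trans hWs,
    fun t => ?_, ?_, ?_, fun hfe t => ?_⟩
  · simp only [hWdef, ← Complex.ofReal_mul, Complex.ofReal_im, Complex.ofReal_re]
    exact ⟨trivial, mul_nonneg hcpos.le (sw_psi_nonneg hη.le _)⟩
  · simp only [norm_mul, mul_pow, Complex.norm_real, Real.norm_of_nonneg hcpos.le]
    rw [integral_const_mul, ← hN, hc, inv_pow, Real.sq_sqrt hNpos.le, inv_mul_cancel₀ hNpos.ne']
  · have hQ' : (weilQuadratic fun t => (c : ℂ) * W t).re = c * c * (weilQuadratic W).re := by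
      rw [weilQuadratic_const_mul, Complex.normSq_ofReal, Complex.re_ofReal_mul]
    rw [hQ', hcc, one_div, inv_mul_eq_div, div_le_iff₀ hNpos]
    nlinarith [hlt]
  · simp only [hWdef]
    rw [hfe]

end Polar

/-! ## The negative-mass criterion -/

/-- **Cone density from negligible polar sign defect** (any window `a > 0`): if for every `δ > 0` the
window carries a real normalised test `f` with `Re Q(f) ≤ ε(a) + δ` whose polar sign defect
`(8cosh a − 4w(2a))∫f⁺∫f⁻` is at most `δ`, then non-negative real window tests are energy-dense among
all normalised window tests. [folklore] -/
theorem sw_coneDense_of_negMass {a : ℝ} (ha : 0 < a)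
    (h : ∀ δ : ℝ, 0 < δ → ∃ f : ℝ → ℝ, IsWeilTest (fun t => ((f t : ℝ) : ℂ)) ∧
      tsupport (fun t => ((f t : ℝ) : ℂ)) ⊆ Icc (-a) a ∧ ∫ t, ‖((f t : ℝ) : ℂ)‖ ^ 2 = 1 ∧
      (weilQuadratic fun t => ((f t : ℝ) : ℂ)).re ≤ weilGroundEnergy a + δ ∧
      (8 * Real.cosh a - 4 * weilArchDensity (2 * a)) * (∫ t, max (f t) 0) * (∫ t, max (-f t) 0) ≤ δ) :
    ∀ g : ℝ → ℂ, IsWeilTest g → tsupport g ⊆ Set.Icc (-a) a → ∫ t, ‖g t‖ ^ 2 = (1 : ℝ) →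
      ∀ δ : ℝ, 0 < δ →
        ∃ w : ℝ → ℂ, IsWeilTest w ∧ tsupport w ⊆ Set.Icc (-a) a ∧
          (∀ t, (w t).im = 0 ∧ 0 ≤ (w t).re) ∧ ∫ t, ‖w t‖ ^ 2 = (1 : ℝ) ∧
          (weilQuadratic w).re ≤ (weilQuadratic g).re + δ := by
  intro g hg hgs hgn δ hδ
  have hδ3 : 0 < δ / 3 := by positivity
  obtain ⟨f, hF, hFs, hFn, hFQ, hFG⟩ := h (δ / 3) hδ3
  obtain ⟨w, hw, hws, hsign, hwn, hwQ, -⟩ := sw_cone_of_real_polar ha hF hFs hFn hδ3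
  have hε : weilGroundEnergy a ≤ (weilQuadratic g).re := weilGroundEnergy_le_of_sphere hg hgs hgn
  exact ⟨w, hw, hws, hsign, hwn, by linarith⟩

/-- **`GSP a` from cone density** (any window `a > 0`): a normalised minimising sequence of cone tests
(`stub_coneMinimizingSeq`), an `L²`-convergent subsequence (CCM25 Thm 3.6), and the sign survives
(`stub_aeNonneg_of_L2_limit`). [folklore] -/
theorem sw_GSP_of_coneDense {a : ℝ} (ha : 0 < a)
    (hcone : ∀ g : ℝ → ℂ, IsWeilTest g → tsupport g ⊆ Set.Icc (-a) a → ∫ t, ‖g t‖ ^ 2 = (1 : ℝ) →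
      ∀ δ : ℝ, 0 < δ →
        ∃ w : ℝ → ℂ, IsWeilTest w ∧ tsupport w ⊆ Set.Icc (-a) a ∧
          (∀ t, (w t).im = 0 ∧ 0 ≤ (w t).re) ∧ ∫ t, ‖w t‖ ^ 2 = (1 : ℝ) ∧
          (weilQuadratic w).re ≤ (weilQuadratic g).re + δ) :
    ∃ u : ℝ → ℂ, IsWeilGroundState a u ∧ ∀ᵐ t : ℝ, (u t).im = 0 ∧ 0 ≤ (u t).re := by
  obtain ⟨g, hg, hQ⟩ := stub_coneMinimizingSeq a ha hcone
  have hg' : ∀ n, IsWeilTest (g n) ∧ tsupport (g n) ⊆ Icc (-a) a ∧ ∫ t, ‖g n t‖ ^ 2 = (1 : ℝ) :=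
    fun n => ⟨(hg n).1, (hg n).2.1, (hg n).2.2.2⟩
  obtain ⟨u, hu, φ, hφ, hconv⟩ :=
    ConnesConsaniMoscovici2025_thm_3_6_holds a ha g hg' hQ.bddAbove_range
  have hQ' : Tendsto (fun n ↦ (weilQuadratic (g (φ n))).re) atTop (𝓝 (weilGroundEnergy a)) :=
    hQ.comp hφ.tendsto_atTop
  have hmem : ∀ n, MemLp (g (φ n)) 2 := fun n => (hg' (φ n)).1.memLp_two
  have hsign := stub_aeNonneg_of_L2_limit (fun n => g (φ n)) u hmem hu
    (fun n t => (hg (φ n)).2.2.1 t) hconv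
  exact ⟨u, ⟨hu, fun n => g (φ n), fun n => hg' (φ n), hQ', hconv⟩, hsign⟩

/-- **The negative-mass criterion for Perron–Frobenius** (any window `a > 0`): real normalised
near-minimisers with negligible polar sign defect `(8cosh a − 4w(2a))∫f⁺∫f⁻` give a ground state of
the FULL windowed Weil form that is real and `≥ 0` a.e. [folklore] -/
theorem sw_GSP_of_negMass {a : ℝ} (ha : 0 < a)
    (h : ∀ δ : ℝ, 0 < δ → ∃ f : ℝ → ℝ, IsWeilTest (fun t => ((f t : ℝ) : ℂ)) ∧
      tsupport (fun t => ((f t : ℝ) : ℂ)) ⊆ Icc (-a) a ∧ ∫ t, ‖((f t : ℝ) : ℂ)‖ ^ 2 = 1 ∧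
      (weilQuadratic fun t => ((f t : ℝ) : ℂ)).re ≤ weilGroundEnergy a + δ ∧
      (8 * Real.cosh a - 4 * weilArchDensity (2 * a)) * (∫ t, max (f t) 0) * (∫ t, max (-f t) 0) ≤ δ) :
    ∃ u : ℝ → ℂ, IsWeilGroundState a u ∧ ∀ᵐ t : ℝ, (u t).im = 0 ∧ 0 ≤ (u t).re :=
  sw_GSP_of_coneDense ha (sw_coneDense_of_negMass ha h)

/-- **The crux from the negative-mass criterion, cofinally**: if beyond every height some window
carries real normalised near-minimisers with negligible polar sign defect, `PolarPerronFrobenius`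
holds (the even-winning hypothesis is a funnel only, `polarPerronFrobenius_of_cofinal_oneSigned`).
[folklore] -/
theorem polarPerronFrobenius_of_cofinal_negMass
    (h : ∀ A : ℝ, ∃ a : ℝ, A ≤ a ∧ 0 < a ∧ ∀ δ : ℝ, 0 < δ → ∃ f : ℝ → ℝ,
      IsWeilTest (fun t => ((f t : ℝ) : ℂ)) ∧ tsupport (fun t => ((f t : ℝ) : ℂ)) ⊆ Icc (-a) a ∧
      ∫ t, ‖((f t : ℝ) : ℂ)‖ ^ 2 = 1 ∧
      (weilQuadratic fun t => ((f t : ℝ) : ℂ)).re ≤ weilGroundEnergy a + δ ∧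
      (8 * Real.cosh a - 4 * weilArchDensity (2 * a)) * (∫ t, max (f t) 0) * (∫ t, max (-f t) 0) ≤ δ) :
    PolarPerronFrobenius := by
  refine polarPerronFrobenius_of_cofinal_oneSigned fun A => ?_
  obtain ⟨a, hA, ha, hneg⟩ := h A
  obtain ⟨u, hu, hsign⟩ := sw_GSP_of_negMass ha hneg
  exact ⟨a, hA, u, hu, hsign.mono fun t ht _ => ht⟩

end Summit.RiemannHypothesis.RiemannHypothesis.Theorems.PolarPerronFrobenius

end
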